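import Summits.QuantumFields.YangMills.Theorems.SwapVirialDeficitSectorLaplaceMainConstFloor
import Summits.QuantumFields.YangMills.Theorems.SwapVirialDeficitSectorLaplaceDefs
import Summits.QuantumFields.YangMills.Theorems.SwapVirialDeficitBlowUpGnomonicEulerJacobian
import HarnessLib

/-!
# (S)-road, stub S4b GIVEN S3: THE QUANTITATIVE FLOOR `e^{−K·L⁸} ≤ 𝔐₀(L)` OF THE MAIN CONSTANT in the letters of ✓`SectorLaplaceDefs`
# (free-hands support of ⟨stmt-QuantumFields-24197⟩ `SwapVirialDeficit.SwapGluedStiffness` ∕ ⟨24194⟩ `SwapMeanActionGap`; cell ym-idea-1, assembler fcl-p3 g47)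

LEAD g97's referee fix (F1) of the (S)-skeleton: the two ABSOLUTE exponentials of the window (S2's off-tube term, S6a's bad signs) are absorbed into
`b^{−1∕4}·(2π∕b)^{9L⁴−1}·𝔐₀` by ✓`exp_absorb` (✓`SectorLaplaceWindow`) PROVIDED `𝔐₀(L) = mbConst L ≥ e^{−K·L^k}`.  LEAD's ✓`mainConst_floor_of_integrable`
(✓`SectorLaplaceMainConstFloor`) gives `K_L·¼·(20400L⁴)^{−α} ≤ K_L·Σ_{ε∈S}∫_cone∫_{ℝ²}𝔪_ε` for any sign set `S ∋ (+…+)`, GIVEN the joint integrability of the all-plus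
Morse–Bott density (stub S3, w2 g59).  This file is the remaining logarithmic arithmetic, in the skeleton's letters:

* §1 `card_fol_le` (`|Fol L| ≤ 6L⁴`, ✓`two_alpha_eq`), `exp_neg_three_le` (`e^{−3} ≤ 1∕20`), `KL_floor` (`e^{−(|log(coneConst³∕64)| + 18L⁴)} ≤ K_L`, from `2π² ≤ 20`),
  `fibre_prefactor_floor` (`e^{−183602·L⁸} ≤ ¼·(20400L⁴)^{−α}`, crude: `log x ≤ x`);
* §2 ★★ `mbConst_floor_of_integrable` — `e^{−(|log(coneConst³∕64)| + 183620)·L⁸} ≤ mbConst L` given S3's integrability for the all-plus pattern;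
  ★ `mbConst_floor_of_S3` — the skeleton's `stub_mbConst_floor_of_S3` VERBATIM (`∃ K > 0, ∃ k, ∀ L, e^{−K L^k} ≤ mbConst L` from the S3 statement).

HONEST LABEL: arithmetic on top of LEAD's floor, CONDITIONAL on stub S3 (stated as a hypothesis, not smuggled); ⟨24197⟩ ∕ ⟨24194⟩ OPEN; ⟨24196⟩ proved elsewhere;
item of record ⟨24085⟩ SubOctaveBounded aside ∕ untouched; the Yang–Mills mass gap is NOT proved; no summit is proved by a line.  THEOREMS ONLY (0 `def`,
0 `sorry`), standard axioms; the `attribute [local instance]` block is the measurable structure on `ℍ` used by every file of the chart (nothing overridden).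
Seat ym-line-fcl-p3 g47 (cell ym-idea-1, free hands), `--supports stmt-QuantumFields-24197`.  References: [cite: Luscher1983, §2]; [folklore].
-/

set_option autoImplicit false
set_option synthInstance.maxSize 1024

noncomputable section

open MeasureTheory Quaternion Set
open scoped Quaternion BigOperators ENNReal
open Literature.MathematicalPhysics.QuantumLattice
open Literature.MathematicalPhysics.QuantumFieldTheory hiding SU2
open Summit.QuantumFields.YangMills.Theorems.SwapTwistDeficit.ToronLog

attribute [local instance] Literature.Analysis.FluidPDE.Tao2016.quatMeasurableSpace
  Literature.Analysis.FluidPDE.Tao2016.quatBorelSpace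
  Literature.MathematicalPhysics.QuantumLattice.secondCountableTopology_su2

namespace Summit.QuantumFields.YangMills.Theorems.SwapVirialDeficit.SectorLaplace

open Summit.QuantumFields.YangMills.Theorems.FemtoTransferGap
open Summit.QuantumFields.YangMills.Theorems.FemtoTransferGap.TT
open Summit.QuantumFields.YangMills.Theorems.VirialFluxGap.RingDeficit
open Summit.QuantumFields.YangMills.Theorems.SwapVirialDeficit.SwapRing
open Summit.QuantumFields.YangMills.Theorems.SwapVirialDeficit.BlowUpRing

variable {L : ℕ} [NeZero L]

/-! ## §1 The logarithmic arithmetic -/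

/-- `|Fol L| ≤ 6L⁴` (✓`two_alpha_eq`: `7 + 3|Fol L| = 18L⁴ − 2`). [folklore] -/
theorem card_fol_le : Fintype.card (Fol L) ≤ 6 * L ^ 4 := by
  have h := two_alpha_eq (L := L)
  generalize Fintype.card (Fol L) = c at h
  generalize L ^ 4 = N at h
  omega

/-- `e^{−3} ≤ 1∕20` (`e ≥ 2.718281828`). [folklore] -/
theorem exp_neg_three_le : Real.exp (-3) ≤ 1 / 20 := by
  have h1 : (2.7182818283 : ℝ) < Real.exp 1 := Real.exp_one_gt_d9
  have h3 : (2.7182818283 : ℝ) ^ 3 ≤ Real.exp 1 ^ 3 := pow_le_pow_left₀ (by norm_num) h1.le 3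
  have h20 : (20 : ℝ) ≤ Real.exp 3 := by
    have e : Real.exp 3 = Real.exp 1 ^ 3 := by rw [Real.exp_one_pow]; norm_num
    rw [e]; exact le_trans (by norm_num) h3
  rw [Real.exp_neg, one_div]
  exact inv_anti₀ (by norm_num) h20

/-- ★ THE CHART-CONSTANT FLOOR: `e^{−(|log(coneConst³∕64)| + 18L⁴)} ≤ K_L = coneConst³∕64·(2π²)^{−|Fol L|}` (`2π² ≤ 20 ≤ e³`, `|Fol L| ≤ 6L⁴`). [folklore] -/
theorem KL_floor : Real.exp (-(|Real.log (coneConst ^ 3 / 64)| + 18 * (L : ℝ) ^ 4)) ≤ KL L := by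
  have hc0 : 0 < coneConst ^ 3 / 64 := by have := coneConst_pos; positivity
  -- the constant
  have h1 : Real.exp (-|Real.log (coneConst ^ 3 / 64)|) ≤ coneConst ^ 3 / 64 := by
    have h : -|Real.log (coneConst ^ 3 / 64)| ≤ Real.log (coneConst ^ 3 / 64) := neg_abs_le _
    calc Real.exp (-|Real.log (coneConst ^ 3 / 64)|) ≤ Real.exp (Real.log (coneConst ^ 3 / 64)) := Real.exp_le_exp.2 h
      _ = coneConst ^ 3 / 64 := Real.exp_log hc0
  -- the power
  have hπ : 1 / 20 ≤ 1 / (2 * Real.pi ^ 2) := by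
    have hp := Real.pi_lt_d2
    have hp0 := Real.pi_pos
    exact div_le_div_of_nonneg_left (by norm_num) (by positivity) (by nlinarith)
  have h2 : Real.exp (-(18 * (L : ℝ) ^ 4)) ≤ (1 / (2 * Real.pi ^ 2)) ^ Fintype.card (Fol L) := by
    have e : Real.exp (-(18 * (L : ℝ) ^ 4)) = Real.exp (-3) ^ (6 * L ^ 4) := by
      rw [← Real.exp_nat_mul]; push_cast; ring_nf
    rw [e]
    calc Real.exp (-3) ^ (6 * L ^ 4) ≤ (1 / 20 : ℝ) ^ (6 * L ^ 4) := pow_le_pow_left₀ (Real.exp_pos _).le exp_neg_three_le _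
      _ ≤ (1 / 20 : ℝ) ^ Fintype.card (Fol L) := pow_le_pow_of_le_one (by norm_num) (by norm_num) card_fol_le
      _ ≤ (1 / (2 * Real.pi ^ 2)) ^ Fintype.card (Fol L) := pow_le_pow_left₀ (by norm_num) hπ _
  unfold KL
  rw [neg_add, Real.exp_add]
  exact mul_le_mul h1 h2 (Real.exp_pos _).le hc0.le

/-- ★ THE FIBRE-PREFACTOR FLOOR: `e^{−183602·L⁸} ≤ ¼·(20400L⁴)^{−α}`, `α = 9L⁴ − 1` (crude: `log x ≤ x`, `¼ ≥ e^{−2}`). [folklore] -/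
theorem fibre_prefactor_floor : Real.exp (-(183602 * (L : ℝ) ^ 8)) ≤ (1 / 4 : ℝ) * (20400 * (L : ℝ) ^ 4) ^ (-alpha L) := by
  have hL1 : (1 : ℝ) ≤ L := by exact_mod_cast NeZero.one_le
  have hL4 : (1 : ℝ) ≤ (L : ℝ) ^ 4 := one_le_pow₀ hL1
  have hx1 : (1 : ℝ) ≤ 20400 * (L : ℝ) ^ 4 := by linarith
  have hx0 : (0 : ℝ) < 20400 * (L : ℝ) ^ 4 := by linarith
  have hα : alpha L = 9 * (L : ℝ) ^ 4 - 1 := by unfold alpha; exact finrank_gnoFibre_real_div_two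
  -- `(20400L⁴)^{−α} ≥ (20400L⁴)^{−9L⁴} = e^{−9L⁴·log(20400L⁴)} ≥ e^{−9L⁴·20400L⁴}`
  have h1 : (20400 * (L : ℝ) ^ 4) ^ (-(9 * (L : ℝ) ^ 4)) ≤ (20400 * (L : ℝ) ^ 4) ^ (-alpha L) :=
    Real.rpow_le_rpow_of_exponent_le hx1 (by rw [hα]; linarith)
  have hlog : Real.log (20400 * (L : ℝ) ^ 4) ≤ 20400 * (L : ℝ) ^ 4 := (Real.log_le_sub_one_of_pos hx0).trans (by linarith)
  have h2 : Real.exp (-(183600 * (L : ℝ) ^ 8)) ≤ (20400 * (L : ℝ) ^ 4) ^ (-(9 * (L : ℝ) ^ 4)) := by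
    rw [Real.rpow_def_of_pos hx0]
    refine Real.exp_le_exp.2 ?_
    have h : Real.log (20400 * (L : ℝ) ^ 4) * (9 * (L : ℝ) ^ 4) ≤ 20400 * (L : ℝ) ^ 4 * (9 * (L : ℝ) ^ 4) :=
      mul_le_mul_of_nonneg_right hlog (by positivity)
    have e : 20400 * (L : ℝ) ^ 4 * (9 * (L : ℝ) ^ 4) = 183600 * (L : ℝ) ^ 8 := by ring
    rw [mul_neg]
    linarith
  -- `¼ ≥ e^{−2}`
  have h4 : Real.exp (-2) ≤ 1 / 4 := by
    have h1' : (2.7182818283 : ℝ) < Real.exp 1 := Real.exp_one_gt_d9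
    have h2' : (2.7182818283 : ℝ) ^ 2 ≤ Real.exp 1 ^ 2 := pow_le_pow_left₀ (by norm_num) h1'.le 2
    have h4' : (4 : ℝ) ≤ Real.exp 2 := by
      have e : Real.exp 2 = Real.exp 1 ^ 2 := by rw [Real.exp_one_pow]; norm_num
      rw [e]; exact le_trans (by norm_num) h2'
    rw [Real.exp_neg, one_div]
    exact inv_anti₀ (by norm_num) h4'
  have hL8 : (1 : ℝ) ≤ (L : ℝ) ^ 8 := one_le_pow₀ hL1
  calc Real.exp (-(183602 * (L : ℝ) ^ 8)) ≤ Real.exp (-2 + -(183600 * (L : ℝ) ^ 8)) := Real.exp_le_exp.2 (by linarith)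
    _ = Real.exp (-2) * Real.exp (-(183600 * (L : ℝ) ^ 8)) := Real.exp_add _ _
    _ ≤ (1 / 4 : ℝ) * (20400 * (L : ℝ) ^ 4) ^ (-(9 * (L : ℝ) ^ 4)) := mul_le_mul h4 h2 (Real.exp_pos _).le (by norm_num)
    _ ≤ (1 / 4 : ℝ) * (20400 * (L : ℝ) ^ 4) ^ (-alpha L) := mul_le_mul_of_nonneg_left h1 (by norm_num)

/-! ## §2 The floor of the main constant, given S3 -/

/-- ★★ **THE QUANTITATIVE FLOOR OF THE MAIN CONSTANT, GIVEN S3**: if the all-plus Morse–Bott density `(a,p) ↦ 𝔪(a, (+…+), p)` is integrable on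
`cone × ℝ²` (stub S3), then `e^{−(|log(coneConst³∕64)| + 183620)·L⁸} ≤ mbConst L` (LEAD ✓`mainConst_floor_of_integrable` + §1). [cite: Luscher1983, §2] -/
theorem mbConst_floor_of_integrable
    (hint : Integrable (fun ap : ℍ × (ℝ × ℝ) => mbDensity (L := L) ap.1 (((true, true), (true, fun _ => true)) : GnoSign L) ap.2)
      (coneMeasure.prod volume)) :
    Real.exp (-((|Real.log (coneConst ^ 3 / 64)| + 183620) * (L : ℝ) ^ 8)) ≤ mbConst L := by
  have hL1 : (1 : ℝ) ≤ L := by exact_mod_cast NeZero.one_le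
  have hKL0 : 0 ≤ KL L := by have := coneConst_pos; unfold KL; positivity
  have hmem : (((true, true), (true, fun _ => true)) : GnoSign L) ∈ Finset.univ.filter (fun ε : GnoSign L => GoodSign ε) := by
    rw [Finset.mem_filter]; exact ⟨Finset.mem_univ _, rfl, rfl⟩
  have hint' := hint
  simp only [mbDensity, fibQ, alpha] at hint'
  have h := mainConst_floor_of_integrable (L := L) hKL0 _ hmem hint'
  have e : mbConst L = KL L * ∑ ε ∈ Finset.univ.filter (fun ε : GnoSign L => GoodSign ε),
      ∫ a, (∫ p : ℝ × ℝ, gnoDensity (gnoBase p.1 p.2 : GnoCoord L) * ((2 * Real.pi) ^ ((Module.finrank ℝ (GnoFibre L) : ℝ) / 2))⁻¹ *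
        ∫ y : GnoFibre L, Real.exp (-(iteratedDeriv 2 (fun s : ℝ => gnoDeficit (fun _ => false) (fun _ => 1) a ε
          (gnoBase p.1 p.2 + s • gnoFibreEmb y)) 0 / 2))) ∂coneMeasure := by
    simp only [mbConst, mbDensity, fibQ, alpha]
  rw [e]
  refine le_trans ?_ h
  -- the arithmetic: `e^{−K L⁸} ≤ K_L · ¼ · (20400L⁴)^{−α}`
  have hα : ((Module.finrank ℝ (GnoFibre L) : ℝ) / 2) = alpha L := rfl
  rw [hα]
  have hL4 : (L : ℝ) ^ 4 ≤ (L : ℝ) ^ 8 := pow_le_pow_right₀ hL1 (by norm_num)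
  have hL8 : (1 : ℝ) ≤ (L : ℝ) ^ 8 := one_le_pow₀ hL1
  have habs : 0 ≤ |Real.log (coneConst ^ 3 / 64)| := abs_nonneg _
  calc Real.exp (-((|Real.log (coneConst ^ 3 / 64)| + 183620) * (L : ℝ) ^ 8))
      ≤ Real.exp (-(|Real.log (coneConst ^ 3 / 64)| + 18 * (L : ℝ) ^ 4) + -(183602 * (L : ℝ) ^ 8)) :=
        Real.exp_le_exp.2 (by nlinarith [habs, hL4, hL8])
    _ = Real.exp (-(|Real.log (coneConst ^ 3 / 64)| + 18 * (L : ℝ) ^ 4)) * Real.exp (-(183602 * (L : ℝ) ^ 8)) := Real.exp_add _ _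
    _ ≤ KL L * ((1 / 4 : ℝ) * (20400 * (L : ℝ) ^ 4) ^ (-alpha L)) :=
        mul_le_mul KL_floor fibre_prefactor_floor (Real.exp_pos _).le hKL0

/-- ★ **STUB S4b OF THE SKELETON, GIVEN STUB S3** (`stub_mbConst_floor_of_S3` VERBATIM): from S3's statement (non-negativity, joint measurability and joint
integrability of `𝔪_ε` for every good sign pattern) — only the integrability of the all-plus pattern is used — `∃ K > 0, ∃ k, ∀ L, e^{−K·L^k} ≤ mbConst L`
(`K = |log(coneConst³∕64)| + 183620`, `k = 8`). [cite: Luscher1983, §2] -/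
theorem mbConst_floor_of_S3
    (hS3 : ∀ (L : ℕ) [NeZero L] (ε : GnoSign L), GoodSign ε →
      (∀ a p, 0 ≤ mbDensity (L := L) a ε p) ∧ Measurable (fun ap : ℍ × (ℝ × ℝ) => mbDensity (L := L) ap.1 ε ap.2) ∧
        Integrable (fun ap : ℍ × (ℝ × ℝ) => mbDensity (L := L) ap.1 ε ap.2) (coneMeasure.prod volume)) :
    ∃ K : ℝ, 0 < K ∧ ∃ k : ℕ, ∀ (L : ℕ) [NeZero L], Real.exp (-(K * (L : ℝ) ^ k)) ≤ mbConst L :=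
  ⟨|Real.log (coneConst ^ 3 / 64)| + 183620, by positivity, 8, fun L _ =>
    mbConst_floor_of_integrable (hS3 L (((true, true), (true, fun _ => true)) : GnoSign L) ⟨rfl, rfl⟩).2.2⟩

end Summit.QuantumFields.YangMills.Theorems.SwapVirialDeficit.SectorLaplace

end
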